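import Summits.MatrixMultiplication.OmegaCensus.DominoLineCertificate
import HarnessLib

/-!
# Sign certificates for the normalised line identity (unit-passing keys with a negative mate)

ω-census `pub-omega`, family (b3), seat pub-omega-group gen 26.  Framing: lottery ticket; floor = certified bounds/negative
ranges.  VALUE: the third certificate kind of the SHADOW-CONSISTENCY route (`HOME/pub-omega-group-g26/FAMILY-B-ADDENDUM-g26.md` §3,
G3): a line key `F` that PASSES the unit test (`DominoLineUnitObstruction.lean`) has, for every shift `s`, a unique rational mate `G_s`
(the line matrix `M_F(τ, v) = F(τ−v) + F(v−τ) + F(τ+v)` is invertible); the pairs `(F, s)` whose mate has a negative entry carry no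
solution, and ONE integer row `y` with `y·M_F = D·e_{v₀}` (`D > 0`) certifies this for every such `s` at once:
`D·G(v₀) = K·Σy − y(s)`, so `K·Σy < y(s)` is impossible for `G ≥ 0`.  NOT progress on ω.

* `line_dual_row_identity`: `y·M_F = D·e_{v₀}` and the line identity give `D·G(v₀) = K·Σ_τ y(τ) − y(s)` (in `ℤ`);
* `no_line_identity_of_sign_row`: hence `K·Σy < y(s)` excludes `(F, s)` for that `K`;
* `signCert p K F certs` (a `Bool`: every `(D, v₀, y)` in `certs` is a dual row, and every `s` in the given list `bad` has a row with
  `K·Σy < y(s)`) and `signCert_sound`: no solution `G` of the identity with shift `s ∈ bad`.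
The fibre size `K = |A|/p` is a parameter (the sign test depends on it: `G_s(v₀) = K/(3|F|) − (M_F⁻¹)_{v₀ s}`).
-/

namespace Summit.MatrixMultiplication.OmegaCensus

open Finset

section Sign

variable {q : ℕ} [NeZero q]

/-- **Dual-row identity.**  If `Σ_τ y(τ)·(F(τ−v)+F(v−τ)+F(τ+v)) = D·[v = v₀]` for all `v`, every solution of the line identity has
`D·G(v₀) = K·Σ_τ y(τ) − y(s)`. [folklore] -/
theorem line_dual_row_identity (F G : ZMod q → ℕ) (s : ZMod q) (K : ℕ)
    (hid : ∀ τ : ZMod q, (∑ v : ZMod q, (F (τ - v) + F (v - τ) + F (τ + v)) * G v) + (if s = τ then 1 else 0) = K)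
    (y : ZMod q → ℤ) (D : ℤ) (v₀ : ZMod q)
    (hy : ∀ v : ZMod q, ∑ τ : ZMod q, y τ * ((F (τ - v) + F (v - τ) + F (τ + v) : ℕ) : ℤ) = if v = v₀ then D else 0) :
    D * (G v₀ : ℤ) = (K : ℤ) * (∑ τ : ZMod q, y τ) - y s := by
  -- pair the identity with `y`
  have h1 : ∑ τ : ZMod q, y τ * (((∑ v : ZMod q, (F (τ - v) + F (v - τ) + F (τ + v)) * G v) +
      (if s = τ then 1 else 0) : ℕ) : ℤ) = ∑ τ : ZMod q, y τ * (K : ℤ) :=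
    sum_congr rfl fun τ _ => by rw [hid τ]
  have h2 : ∑ τ : ZMod q, y τ * (((∑ v : ZMod q, (F (τ - v) + F (v - τ) + F (τ + v)) * G v : ℕ) : ℤ)) =
      ∑ v : ZMod q, (∑ τ : ZMod q, y τ * ((F (τ - v) + F (v - τ) + F (τ + v) : ℕ) : ℤ)) * (G v : ℤ) := by
    simp_rw [Nat.cast_sum, Nat.cast_mul, mul_sum, sum_mul]
    rw [sum_comm]
    exact sum_congr rfl fun v _ => sum_congr rfl fun τ _ => by ring
  have h3 : ∑ v : ZMod q, (∑ τ : ZMod q, y τ * ((F (τ - v) + F (v - τ) + F (τ + v) : ℕ) : ℤ)) * (G v : ℤ) = D * (G v₀ : ℤ) := by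
    simp_rw [hy]
    simp only [ite_mul, zero_mul, sum_ite_eq', mem_univ, if_true]
  have h4 : ∑ τ : ZMod q, y τ * ((if s = τ then 1 else 0 : ℕ) : ℤ) = y s := by
    simp only [Nat.cast_ite, Nat.cast_one, Nat.cast_zero, mul_ite, mul_one, mul_zero, sum_ite_eq, mem_univ, if_true]
  simp_rw [Nat.cast_add, mul_add, sum_add_distrib] at h1
  rw [h2, h3, h4, ← sum_mul] at h1
  linear_combination h1

/-- **Exclusion by a sign row**: with a dual row as above, `K·Σy < y(s)` contradicts `G ≥ 0` when `D > 0`. [folklore] -/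
theorem no_line_identity_of_sign_row (F G : ZMod q → ℕ) (s : ZMod q) (K : ℕ)
    (hid : ∀ τ : ZMod q, (∑ v : ZMod q, (F (τ - v) + F (v - τ) + F (τ + v)) * G v) + (if s = τ then 1 else 0) = K)
    (y : ZMod q → ℤ) (D : ℤ) (v₀ : ZMod q) (hD : 0 < D)
    (hy : ∀ v : ZMod q, ∑ τ : ZMod q, y τ * ((F (τ - v) + F (v - τ) + F (τ + v) : ℕ) : ℤ) = if v = v₀ then D else 0)
    (hneg : (K : ℤ) * (∑ τ : ZMod q, y τ) < y s) : False := by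
  have h := line_dual_row_identity F G s K hid y D v₀ hy
  have hG : (0 : ℤ) ≤ D * (G v₀ : ℤ) := mul_nonneg hD.le (Nat.cast_nonneg _)
  rw [h] at hG
  linarith

/-- A list of integers read as a function on `ZMod q`. [folklore] -/
def vecFnZ (l : List ℤ) : ZMod q → ℤ := fun v => l.getD v.val 0

/-- **Sign certificate check** for key `F`, fibre size `K`, excluded shifts `bad`: every row `(D, v₀, y)` satisfies `D > 0` and
`y·M_F = D·e_{v₀}`, and every `s ∈ bad` has a row with `K·Σy < y(s)`. [folklore] -/
def signCert (q : ℕ) [NeZero q] (K : ℕ) (F : ZMod q → ℕ) (rows : List (ℤ × ℕ × List ℤ)) (bad : List ℕ) : Bool :=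
  decide ((∀ c ∈ rows, 0 < c.1 ∧ ∀ v : ZMod q,
      ∑ τ : ZMod q, c.2.2.getD τ.val 0 * ((F (τ - v) + F (v - τ) + F (τ + v) : ℕ) : ℤ) =
        if v.val = c.2.1 then c.1 else 0) ∧
    ∀ b ∈ bad, ∃ c ∈ rows, (K : ℤ) * (∑ τ : ZMod q, c.2.2.getD τ.val 0) < c.2.2.getD (b % q) 0)

/-- **Soundness of the sign certificate**: no solution of the line identity with key `F`, fibre size `K` and a shift `s` whose
residue is listed in `bad`. [folklore] -/
theorem signCert_sound {K : ℕ} {F : ZMod q → ℕ} {rows : List (ℤ × ℕ × List ℤ)} {bad : List ℕ}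
    (h : signCert q K F rows bad = true) (G : ZMod q → ℕ) (s : ZMod q) (hs : s.val ∈ bad)
    (hid : ∀ τ : ZMod q, (∑ v : ZMod q, (F (τ - v) + F (v - τ) + F (τ + v)) * G v) + (if s = τ then 1 else 0) = K) :
    False := by
  obtain ⟨hrows, hbad⟩ := of_decide_eq_true h
  obtain ⟨c, hc, hlt⟩ := hbad s.val hs
  obtain ⟨hD, hyc⟩ := hrows c hc
  have hv₀ : c.2.1 < q ∨ q ≤ c.2.1 := lt_or_ge _ _
  -- the row is a dual row for `v₀ = c.2.1` (as an element of `ZMod q`) when `c.2.1 < q`; otherwise it is the zero functional, impossible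
  rcases hv₀ with hlt' | hge
  · refine no_line_identity_of_sign_row F G s K hid (vecFnZ c.2.2) c.1 (c.2.1 : ZMod q) hD (fun v => ?_) ?_
    · by_cases hv : v = (c.2.1 : ZMod q)
      · have hv' : v.val = c.2.1 := by rw [hv, ZMod.val_cast_of_lt hlt']
        have := hyc v
        rw [if_pos hv'] at this
        rw [if_pos hv]
        exact this
      · have hv' : v.val ≠ c.2.1 := fun e => hv (by rw [← e, ZMod.natCast_zmod_val])
        have := hyc v
        rw [if_neg hv'] at this
        rw [if_neg hv]
        exact this
    · have e : s.val % q = s.val := Nat.mod_eq_of_lt (ZMod.val_lt s)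
      rw [e] at hlt
      exact hlt
  · -- `v.val = c.2.1` is never true, so the row is the zero functional: pairing the identity with it gives `0 = K·Σy − y(s)`,
    -- contradicting `K·Σy < y(s)`.
    have hy0 : ∀ v : ZMod q, ∑ τ : ZMod q, vecFnZ c.2.2 τ * ((F (τ - v) + F (v - τ) + F (τ + v) : ℕ) : ℤ) =
        if v = (0 : ZMod q) then (0 : ℤ) * 1 else 0 := by
      intro v
      have hne : v.val ≠ c.2.1 := fun e => absurd (e ▸ ZMod.val_lt v) (not_lt.2 hge)
      have := hyc v
      rw [if_neg hne] at this
      simp only [zero_mul, ite_self]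
      exact this
    have h0 := line_dual_row_identity F G s K hid (vecFnZ c.2.2) (0 * 1) 0 hy0
    have e : s.val % q = s.val := Nat.mod_eq_of_lt (ZMod.val_lt s)
    rw [e] at hlt
    change (K : ℤ) * (∑ τ : ZMod q, vecFnZ c.2.2 τ) < vecFnZ c.2.2 s at hlt
    linarith

end Sign

end Summit.MatrixMultiplication.OmegaCensus
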